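import Summits.BirchSwinnertonDyer.Rank1Residual.Supersingular.RankOneKimLevelKRecordShape
import Summits.BirchSwinnertonDyer.Rank1Residual.Supersingular.RankOneRem13NoCertificate
import Summits.BirchSwinnertonDyer.Rank1Residual.Supersingular.CountPointsFast
import HarnessLib

/-!
# Rank ONE at `p = 3`, class X7 (O4@3), `#Ш_an = 9`: the level-`3^k` PRIME-level Kurihara-number RECORD SHAPE
# read off an integer model / a literal equation — the X7 twin of gen 21's `RankOneKimLevelKRecordShape` §2–§3
# (cell `b2b-bsdres`, supersingular family prover B = unit `b2b-bsdres-additive-p3`, gen 23; class lead N6·O3, X7 joint B side)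

HONEST FRAMING (run/shared/lean/b2b/bsd-rank1-residual/, verbatim in every file): the goal of the
cell is to DELETE the COMBINATION-SHAPED residual classes of the Birch–Swinnerton-Dyer formula for
ALL analytic-rank `≤ 1` elliptic curves over `ℚ` — "full BSD formula for every rank `≤ 1` curve in
class `C`" assembled STRICTLY from published theorems — so that the rank-`≤ 1` remainder becomes
exactly the CONSTRUCTION-SHAPED classes, which are TYPED (missing-input `Prop`s), NOT attempted.
This is not "finishing BSD". X7 / X8 stay CONSTRUCTION-SHAPED; THEOREMS ONLY (compositions of tree
theorems BY NAME; no definition, no named fact, debt 0); per pair; NOT class theorems; nothing booked;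
O4's mark does not move. Every theorem carries `hK25s : Kim2025.thm11_kimShaLength_of_integralPeriod_OPEN`
— CONDITIONAL on the ANNOUNCED preprint C.-H. Kim (app. R. Pollack), arXiv:2505.09121 (OPEN binder; its
`p = 3` Kolyvagin systems = Sakamoto, JTNB 36 (2024), refereed); `hCT` / `hGZK` / `hmod` are PUBLISHED.

## Why

Gen 21's `RankOneKimLevelKRecordShape.lean` (p307326) gave, for O3 = X8 ∧ `r_an = 1` ∧ `#Ш_an = 9`, the
literal-equation record shape `X8RankOne.bsdp_three_of_kim2025_OPEN_of_ainvs_of_kuriharaNumber_ne_zero_of_card_selmerGroup`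
(`BSD(E,3)` from ONE Kurihara number `δ̃_ℓ ≢ 0 (mod 3^k)` at a cyclic `ℓ ∈ 𝒫_k`, `k ≤ 4`, plus the two-engine
descent count `9 ∣ #Sel^(3)`), and only the MODEL-FREE X7 twin
`X7RankOne.bsdp_three_of_kim2025_OPEN_of_kuriharaNumber_ne_zero_of_card_selmerGroup_of_surj`. iw-2's ENGINE K
v1.3 depth-3 production (GEN 12, population R1k3, `q = 27`, `ν = 1`; `HOME/b2b-bsdres-iw-2/ENGINE-K-P9.md` §4,
`tables/engKp9_{pairs,levels}.tsv`) now tables a non-zero `δ̃_ℓ mod 27` at a cyclic `ℓ ∈ 𝒫_3` for EVERY one of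
the 52 open rank-one `#Ш_an = 9`, `3 ∤ ∏c_ℓ` cells at `p = 3` — 32 of them O4@3 = X7@3. This file supplies
the X7 integer-model / literal-equation shapes those 32 records instantiate (one `exact` per curve).

## What

* §1 `X7RankOne.bsdp_three_of_kim2025_OPEN_of_intModel_of_kuriharaNumber_ne_zero_of_card_selmerGroup` — on an
  integer model `integralModelInt W = E₀`: class X7 from `3 ∤ Δ(E₀)`, a point count `#(E₀ mod 3)(𝔽₃) = n₃` with
  `3 ∣ 3 + 1 − n₃` (good supersingular) and an ADDITIVE prime `q' ∣ Δ(E₀)`, `q' ∣ c₄(E₀)` (gen 20's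
  `classX7_of_intModel`); `ℓ ∈ 𝒫_k` from `ℓ ≠ 3`, `ℓ ∤ Δ(E₀)`, `ℓ ≡ 1 (mod 3^k)`, `#(E₀ mod ℓ)(𝔽_ℓ) = n_ℓ`,
  `3^k ∣ n_ℓ` (n1011's `isKolyvaginPrime_of_intModel_of_card`); CYCLICITY `#Ẽ(𝔽_ℓ)[3] ≤ 3` from the CUBE TEST
  `Δ(E₀ mod ℓ) ≠ 0`, `Δ(E₀ mod ℓ)^{(ℓ−1)/3} ≠ 1` (n1011-p15's `card_three_torsion_le_of_intModel_of_pow_div_three_ne_one`);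
  then gen 21's model-free X7 theorem.
* §2 `X7RankOne.bsdp_three_of_kim2025_OPEN_of_ainvs_of_kuriharaNumber_ne_zero_of_card_selmerGroup` — the literal
  equation `[a₁,…,a₆]` with NO instance hypothesis (`IsElliptic` from `Δ ≠ 0`, minimality explicit), x11c's schema
  count at `3`, everything else as §1; and `…_of_countPointsFast` — the same with the level count supplied as
  prover A's `countPointsFast [a] ℓ = n_ℓ` (binary modular exponentiation, `CountPointsFast.lean` p308351), the
  kernel-cheap form for the engine-K primes `ℓ ≤ 18 523` of this population.

Binders left per record: `hK25s` (OPEN); `hCT`, `hGZK`, `hmod` (PUBLISHED); `D` (newform `D.f`); `hsurj` (= gen 21's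
certificate `surj_x7r1_<label>_3`); a `ψ` surjective at `ℓ` with `kuriharaNumber D.f (3^k) ℓ ψ ≠ 0` (engine datum);
`hcard : 9 ∣ #Sel^(3)(E/ℚ)` (gen 19's two-engine descent count); `r_an = 1`, `#Ш_an = q` with `ord₃ q = 2` (Cremona).
NOT claimed: no class theorem; the number `δ̃_ℓ` is NOT computed here; nothing booked.

References: [Kim2025RefinedTNC] Thm. 1.1 (ANNOUNCED, OPEN binder); [Kim2022StructureSelmer] §1.2.2, Thm. 1.10 (1),
Conj. 1.10; [SilvermanAEC2009] III.1, VII.1, VII.5 Prop. 5.1 (a),(c), X.4.2 (a), X.4.14; [Wuthrich2014] Lemma 20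
(p. 399); [IrelandRosen1990] Prop. 5.1.2; [Cremona1997] §3.6; [Miller2011LMS] Def. 1.1.
-/

set_option autoImplicit false

noncomputable section

open scoped Classical MatrixGroups ModularForm

open CongruenceSubgroup WeierstrassCurve Literature.NumberTheory.EllipticCurves
  Literature.NumberTheory.EllipticCurves.ModularForms
  Literature.NumberTheory.EllipticCurves.Rank1Residual
  Literature.NumberTheory.EllipticCurves.Rank1Residual.Typed
  Literature.NumberTheory.EllipticCurves.Rank1Residual.X11RankOneCertificates
  Summit.BirchSwinnertonDyer.BirchSwinnertonDyer.Rank1Residual.IntModel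
  Summit.BirchSwinnertonDyer.BirchSwinnertonDyer.Rank1Residual.X11RankOne
  Summit.BirchSwinnertonDyer.Rank1Residual.X11b
  Summit.BirchSwinnertonDyer.Rank1Residual.Additive

namespace Summit.BirchSwinnertonDyer.Rank1Residual.Supersingular

/-! ### §1 Integer model `integralModelInt W = E₀` (class X7 at `3`, `#Ш_an = 9`) -/

section IntModel

variable {W : WeierstrassCurve ℚ} [W.IsElliptic] [W.IsGloballyMinimal] {E₀ : WeierstrassCurve ℤ}

/-- **Integer-model END (X7@3 ∧ `r_an = 1` ∧ surj(3), `ord₃ #Ш_an = 2`)**: class X7 from `3 ∤ Δ(E₀)`,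
`#(E₀ mod 3)(𝔽₃) = n₃` with `3 ∣ 3 + 1 − n₃` and an additive prime `q' ∣ Δ(E₀)`, `q' ∣ c₄(E₀)`; `ℓ ∈ 𝒫_k`
from `ℓ ≠ 3`, `ℓ ∤ Δ(E₀)`, `ℓ ≡ 1 (mod 3^k)`, `#(E₀ mod ℓ)(𝔽_ℓ) = n_ℓ`, `3^k ∣ n_ℓ`; CYCLICITY from the cube
test `Δ(E₀ mod ℓ) ≠ 0`, `Δ(E₀ mod ℓ)^{(ℓ−1)/3} ≠ 1`; then gen 21's model-free
`X7RankOne.bsdp_three_of_kim2025_OPEN_of_kuriharaNumber_ne_zero_of_card_selmerGroup_of_surj` (`1 ≤ k ≤ 4`, the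
descent count `9 ∣ #Sel^(3)`, `ord₃ #Ш_an = 2`). CONDITIONAL on `hK25s` (OPEN); X7 joint pair, B side. Per
pair; NOT a class theorem. [claim: Kim2025RefinedTNC, status: under-review]
[cite: Kim2025RefinedTNC, Thm. 1.1 (ANNOUNCED, OPEN binder)] [cite: Kim2022StructureSelmer, §1.2.2 and Thm. 1.10 (1)]
[cite: SilvermanAEC2009, III.1, VII.5 Prop. 5.1(a) and (c), Thm. X.4.2(a), Thm. X.4.14] [cite: Miller2011LMS, §1 and Def. 1.1] -/
theorem X7RankOne.bsdp_three_of_kim2025_OPEN_of_intModel_of_kuriharaNumber_ne_zero_of_card_selmerGroup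
    (hK25s : Kim2025.thm11_kimShaLength_of_integralPeriod_OPEN)
    (hCT : exists_casselsTate_pairing (K := ℚ))
    (hGZK : rank_eq_analyticRank_of_analyticRank_le_one) (hmod : hasEntireLFunction_rat)
    (hI : integralModelInt W = E₀) (h3Δ : ¬ (3 : ℤ) ∣ E₀.Δ) {n₃ : ℕ}
    (hn₃ : Nat.card ((E₀.map (Int.castRingHom (ZMod 3))).toAffine.Point) = n₃)
    (ha₃ : (3 : ℤ) ∣ (3 : ℤ) + 1 - n₃)
    (q' : ℕ) (hq' : q'.Prime) (hqΔ : (q' : ℤ) ∣ E₀.Δ) (hqc₄ : (q' : ℤ) ∣ E₀.c₄)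
    (hs : Surj W 3) (hr : W.analyticRank = 1)
    {N : ℕ} [NeZero N] (D : ModularParametrizationData W N)
    {k : ℕ} (hk : 1 ≤ k) (hk4 : k ≤ 4) (ℓ : ℕ) [Fact ℓ.Prime] (hℓ3 : ℓ ≠ 3) (h5 : 5 ≤ ℓ)
    (hℓΔ : ¬ (ℓ : ℤ) ∣ E₀.Δ) (h1 : ℓ ≡ 1 [MOD 3 ^ k]) {nℓ : ℕ}
    (hnℓ : Nat.card ((E₀.map (Int.castRingHom (ZMod ℓ))).toAffine.Point) = nℓ) (hdvd : 3 ^ k ∣ nℓ)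
    (hΔ0 : (E₀.map (Int.castRingHom (ZMod ℓ))).Δ ≠ 0)
    (hχ : (E₀.map (Int.castRingHom (ZMod ℓ))).Δ ^ ((ℓ - 1) / 3) ≠ 1)
    (ψ : (ℓ'' : ℕ) → (ZMod ℓ'')ˣ →* Multiplicative (ZMod (3 ^ k)))
    (hψ : Function.Surjective (ψ ℓ)) (hδ : kuriharaNumber D.f (3 ^ k) ℓ ψ ≠ 0)
    (hcard : 3 ^ 2 ∣ Nat.card (W.selmerGroup ((3 : ℕ) : ℤ)))
    {q : ℚ} (hq : shaAn W = (q : ℂ)) (hv : padicValRat 3 q = 2) : BSDp W 3 :=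
  haveI : Fact (Nat.Prime 3) := ⟨by norm_num⟩
  X7RankOne.bsdp_three_of_kim2025_OPEN_of_kuriharaNumber_ne_zero_of_card_selmerGroup_of_surj W hK25s hCT
    hGZK hmod hr (classX7_of_intModel (p := 3) hI h3Δ hn₃ ha₃ q' hq' hqΔ hqc₄) hs D hk hk4 ℓ
    (isKolyvaginPrime_of_intModel_of_card hI 3 k ℓ hℓ3 hℓΔ h1 hnℓ hdvd)
    (card_three_torsion_le_of_intModel_of_pow_div_three_ne_one hI ℓ hΔ0 hχ h5
      (three_dvd_sub_one_of_modEq_pow hk h1)) ψ hψ hδ hcard hq hv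

end IntModel

/-! ### §2 Literal integer equations `[a₁, a₂, a₃, a₄, a₆]` -/

section Literal

/-- **RECORD SHAPE (O4@3's `#Ш_an = 9` rows).** For an integer equation `[a₁,…,a₆]`: `hmin` global
minimality (explicit — x11c's bounded criterion, decided by the record), `3 ∤ Δ`, schema count
`countPoints [a] 3 = n₃` with `3 ∣ 3 + 1 − n₃` and an ADDITIVE prime `q'` (`q' ∣ Δ`, `q' ∣ c₄`; class X7); a
prime `ℓ ≥ 5`, `ℓ ∤ Δ`, `ℓ ≡ 1 (mod 3^k)` (`1 ≤ k ≤ 4`), `#(E mod ℓ)(𝔽_ℓ) = n_ℓ` (any kernel form), `3^k ∣ n_ℓ`,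
and the CUBE TEST `(Δ : ℤ/ℓ) ≠ 0`, `(Δ : ℤ/ℓ)^{(ℓ−1)/3} ≠ 1` — ALL kernel-decidable (the prime fact is the
named instance binder `hℓ`, supplied by a record as `(hℓ := ⟨by norm_num⟩)`); binders: `hsurj` (= gen 21's
certificate `surj_x7r1_<label>_3`), `r_an = 1`, `D`, a `ψ` surjective at `ℓ` with
`kuriharaNumber D.f (3^k) ℓ ψ ≠ 0`, the two-engine descent count `9 ∣ #Sel^(3)`, `#Ш_an = q`, `ord₃ q = 2`
⇒ **`BSD(E,3)`**. CONDITIONAL on `hK25s` (OPEN) + `hCT`/`hGZK`/`hmod` (PUBLISHED). Per pair; NOT a class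
theorem; nothing booked. [claim: Kim2025RefinedTNC, status: under-review]
[cite: Kim2025RefinedTNC, Thm. 1.1 (ANNOUNCED, OPEN binder)] [cite: Kim2022StructureSelmer, §1.2.2 and Thm. 1.10 (1)]
[cite: SilvermanAEC2009, III.1, VII.1 Remark 1.1, VII.5 Prop. 5.1(a) and (c), Thm. X.4.2(a), Thm. X.4.14]
[cite: IrelandRosen1990, Prop. 5.1.2 and §8.1] [cite: Miller2011LMS, §1 and Def. 1.1] -/
theorem X7RankOne.bsdp_three_of_kim2025_OPEN_of_ainvs_of_kuriharaNumber_ne_zero_of_card_selmerGroup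
    (hK25s : Kim2025.thm11_kimShaLength_of_integralPeriod_OPEN)
    (hCT : exists_casselsTate_pairing (K := ℚ))
    (hGZK : rank_eq_analyticRank_of_analyticRank_le_one) (hmod : hasEntireLFunction_rat)
    (a1 a2 a3 a4 a6 : ℤ) (hmin : (⟨a1, a2, a3, a4, a6⟩ : WeierstrassCurve ℚ).IsGloballyMinimal)
    (h3Δ : ¬ (3 : ℤ) ∣ discOf [a1, a2, a3, a4, a6]) {n₃ : ℕ}
    (hc₃ : countPoints [a1, a2, a3, a4, a6] 3 = n₃) (ha₃ : (3 : ℤ) ∣ (3 : ℤ) + 1 - n₃)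
    (q' : ℕ) (hq' : q'.Prime) (hqΔ : (q' : ℤ) ∣ discOf [a1, a2, a3, a4, a6])
    (hqc₄ : (q' : ℤ) ∣ c4Of [a1, a2, a3, a4, a6])
    (hsurj : Surj (⟨a1, a2, a3, a4, a6⟩ : WeierstrassCurve ℚ) 3)
    (hr : (⟨a1, a2, a3, a4, a6⟩ : WeierstrassCurve ℚ).analyticRank = 1)
    {N : ℕ} [NeZero N] (D : ModularParametrizationData (⟨a1, a2, a3, a4, a6⟩ : WeierstrassCurve ℚ) N)
    {k : ℕ} (hk : 1 ≤ k) (hk4 : k ≤ 4) (ℓ : ℕ) [hℓ : Fact ℓ.Prime] (h5 : 5 ≤ ℓ)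
    (hℓΔ : ¬ (ℓ : ℤ) ∣ discOf [a1, a2, a3, a4, a6]) (h1 : ℓ ≡ 1 [MOD 3 ^ k]) {nℓ : ℕ}
    (hnℓ : Nat.card (((⟨a1, a2, a3, a4, a6⟩ : WeierstrassCurve ℤ).map
      (Int.castRingHom (ZMod ℓ))).toAffine.Point) = nℓ) (hdvd : 3 ^ k ∣ nℓ)
    (hΔ0 : ((discOf [a1, a2, a3, a4, a6] : ℤ) : ZMod ℓ) ≠ 0)
    (hχ : ((discOf [a1, a2, a3, a4, a6] : ℤ) : ZMod ℓ) ^ ((ℓ - 1) / 3) ≠ 1)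
    (ψ : (ℓ'' : ℕ) → (ZMod ℓ'')ˣ →* Multiplicative (ZMod (3 ^ k)))
    (hψ : Function.Surjective (ψ ℓ))
    (hδ : kuriharaNumber D.f (3 ^ k) ℓ ψ ≠ 0)
    (hcard : 3 ^ 2 ∣ Nat.card ((⟨a1, a2, a3, a4, a6⟩ : WeierstrassCurve ℚ).selmerGroup ((3 : ℕ) : ℤ)))
    {q : ℚ} (hq : shaAn (⟨a1, a2, a3, a4, a6⟩ : WeierstrassCurve ℚ) = (q : ℂ)) (hv : padicValRat 3 q = 2) :
    BSDp (⟨a1, a2, a3, a4, a6⟩ : WeierstrassCurve ℚ) 3 := by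
  have h0 : discOf [a1, a2, a3, a4, a6] ≠ 0 := fun h ↦ h3Δ (by rw [h]; exact dvd_zero _)
  haveI := isElliptic_of_discOf_ne_zero a1 a2 a3 a4 a6 h0
  haveI := hmin
  haveI : Fact (Nat.Prime 3) := ⟨by norm_num⟩
  have hI : integralModelInt (⟨a1, a2, a3, a4, a6⟩ : WeierstrassCurve ℚ) = ⟨a1, a2, a3, a4, a6⟩ :=
    integralModelInt_eq_of_map_eq _ (map_mk_int a1 a2 a3 a4 a6)
  have hΔℓ : ((⟨a1, a2, a3, a4, a6⟩ : WeierstrassCurve ℤ).map (Int.castRingHom (ZMod ℓ))).Δ =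
      ((discOf [a1, a2, a3, a4, a6] : ℤ) : ZMod ℓ) := by
    rw [WeierstrassCurve.map_Δ, intCurve_Δ, eq_intCast]
  exact X7RankOne.bsdp_three_of_kim2025_OPEN_of_intModel_of_kuriharaNumber_ne_zero_of_card_selmerGroup
    hK25s hCT hGZK hmod hI (by rw [intCurve_Δ]; exact h3Δ)
    (natCard_point_eq_of_countPoints a1 a2 a3 a4 a6 3 (by decide) h3Δ hc₃) ha₃ q' hq'
    (by rw [intCurve_Δ]; exact hqΔ) (by rw [intCurve_c₄]; exact hqc₄) hsurj hr D hk hk4 ℓ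
    (by omega) h5 (by rw [intCurve_Δ]; exact hℓΔ) h1 hnℓ hdvd (by rw [hΔℓ]; exact hΔ0)
    (by rw [hΔℓ]; exact hχ) ψ hψ hδ hcard hq hv

/-- **RECORD SHAPE, FAST COUNT (O4@3's `#Ш_an = 9` rows)** — as the previous theorem, with the level count
supplied in prover A's kernel-cheap form `countPointsFast [a₁,…,a₆] ℓ = n_ℓ` (binary modular exponentiation;
`countPoints_eq_of_fast` + x11c's `natCard_point_eq_of_countPoints`), for the engine-K primes `ℓ` up to
`18 523` of the R1k3 population. CONDITIONAL on `hK25s` (OPEN). Per pair; NOT a class theorem; nothing booked.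
[claim: Kim2025RefinedTNC, status: under-review] [cite: Kim2025RefinedTNC, Thm. 1.1 (ANNOUNCED, OPEN binder)]
[cite: Kim2022StructureSelmer, §1.2.2 and Thm. 1.10 (1)] [cite: SilvermanAEC2009, VII.5 Prop. 5.1(a) and (c), Thm. X.4.14]
[cite: IrelandRosen1990, Prop. 5.1.2 and §8.1] [cite: Miller2011LMS, §1 and Def. 1.1] -/
theorem X7RankOne.bsdp_three_of_kim2025_OPEN_of_ainvs_of_kuriharaNumber_ne_zero_of_card_selmerGroup_of_countPointsFast
    (hK25s : Kim2025.thm11_kimShaLength_of_integralPeriod_OPEN)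
    (hCT : exists_casselsTate_pairing (K := ℚ))
    (hGZK : rank_eq_analyticRank_of_analyticRank_le_one) (hmod : hasEntireLFunction_rat)
    (a1 a2 a3 a4 a6 : ℤ) (hmin : (⟨a1, a2, a3, a4, a6⟩ : WeierstrassCurve ℚ).IsGloballyMinimal)
    (h3Δ : ¬ (3 : ℤ) ∣ discOf [a1, a2, a3, a4, a6]) {n₃ : ℕ}
    (hc₃ : countPoints [a1, a2, a3, a4, a6] 3 = n₃) (ha₃ : (3 : ℤ) ∣ (3 : ℤ) + 1 - n₃)
    (q' : ℕ) (hq' : q'.Prime) (hqΔ : (q' : ℤ) ∣ discOf [a1, a2, a3, a4, a6])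
    (hqc₄ : (q' : ℤ) ∣ c4Of [a1, a2, a3, a4, a6])
    (hsurj : Surj (⟨a1, a2, a3, a4, a6⟩ : WeierstrassCurve ℚ) 3)
    (hr : (⟨a1, a2, a3, a4, a6⟩ : WeierstrassCurve ℚ).analyticRank = 1)
    {N : ℕ} [NeZero N] (D : ModularParametrizationData (⟨a1, a2, a3, a4, a6⟩ : WeierstrassCurve ℚ) N)
    {k : ℕ} (hk : 1 ≤ k) (hk4 : k ≤ 4) (ℓ : ℕ) [hℓ : Fact ℓ.Prime] (h5 : 5 ≤ ℓ)
    (hℓΔ : ¬ (ℓ : ℤ) ∣ discOf [a1, a2, a3, a4, a6]) (h1 : ℓ ≡ 1 [MOD 3 ^ k]) {nℓ : ℕ}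
    (hnℓ : countPointsFast [a1, a2, a3, a4, a6] ℓ = nℓ) (hdvd : 3 ^ k ∣ nℓ)
    (hΔ0 : ((discOf [a1, a2, a3, a4, a6] : ℤ) : ZMod ℓ) ≠ 0)
    (hχ : ((discOf [a1, a2, a3, a4, a6] : ℤ) : ZMod ℓ) ^ ((ℓ - 1) / 3) ≠ 1)
    (ψ : (ℓ'' : ℕ) → (ZMod ℓ'')ˣ →* Multiplicative (ZMod (3 ^ k)))
    (hψ : Function.Surjective (ψ ℓ))
    (hδ : kuriharaNumber D.f (3 ^ k) ℓ ψ ≠ 0)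
    (hcard : 3 ^ 2 ∣ Nat.card ((⟨a1, a2, a3, a4, a6⟩ : WeierstrassCurve ℚ).selmerGroup ((3 : ℕ) : ℤ)))
    {q : ℚ} (hq : shaAn (⟨a1, a2, a3, a4, a6⟩ : WeierstrassCurve ℚ) = (q : ℂ)) (hv : padicValRat 3 q = 2) :
    BSDp (⟨a1, a2, a3, a4, a6⟩ : WeierstrassCurve ℚ) 3 :=
  X7RankOne.bsdp_three_of_kim2025_OPEN_of_ainvs_of_kuriharaNumber_ne_zero_of_card_selmerGroup hK25s hCT hGZK
    hmod a1 a2 a3 a4 a6 hmin h3Δ hc₃ ha₃ q' hq' hqΔ hqc₄ hsurj hr D hk hk4 ℓ h5 hℓΔ h1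
    (natCard_point_eq_of_countPoints a1 a2 a3 a4 a6 ℓ (by omega) hℓΔ
      (countPoints_eq_of_fast hnℓ)) hdvd hΔ0 hχ ψ hψ hδ hcard hq hv

/-- **RECORD SHAPE, FAST COUNT (O3's `#Ш_an = 9` rows, class X8)** — gen 21's
`X8RankOne.bsdp_three_of_kim2025_OPEN_of_ainvs_of_kuriharaNumber_ne_zero_of_card_selmerGroup` with the level
count in the `countPointsFast` form (for the engine-K prime `ℓ = 13 177` of 323219e1 and later large primes).
CONDITIONAL on `hK25s` (OPEN). Per pair; NOT a class theorem; nothing booked.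
[claim: Kim2025RefinedTNC, status: under-review] [cite: Kim2025RefinedTNC, Thm. 1.1 (ANNOUNCED, OPEN binder)]
[cite: Kim2022StructureSelmer, §1.2.2 and Thm. 1.10 (1)] [cite: SilvermanAEC2009, VII.5 Prop. 5.1(a), Thm. X.4.14]
[cite: IrelandRosen1990, Prop. 5.1.2 and §8.1] [cite: Miller2011LMS, §1 and Def. 1.1] -/
theorem X8RankOne.bsdp_three_of_kim2025_OPEN_of_ainvs_of_kuriharaNumber_ne_zero_of_card_selmerGroup_of_countPointsFast
    (hK25s : Kim2025.thm11_kimShaLength_of_integralPeriod_OPEN)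
    (hCT : exists_casselsTate_pairing (K := ℚ))
    (hGZK : rank_eq_analyticRank_of_analyticRank_le_one) (hmod : hasEntireLFunction_rat)
    (a1 a2 a3 a4 a6 : ℤ) (hmin : (⟨a1, a2, a3, a4, a6⟩ : WeierstrassCurve ℚ).IsGloballyMinimal)
    (h3Δ : ¬ (3 : ℤ) ∣ discOf [a1, a2, a3, a4, a6]) {n₃ : ℕ}
    (hc₃ : countPoints [a1, a2, a3, a4, a6] 3 = n₃) (hn17 : n₃ = 1 ∨ n₃ = 7)
    (hsurj : Surj (⟨a1, a2, a3, a4, a6⟩ : WeierstrassCurve ℚ) 3)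
    (hr : (⟨a1, a2, a3, a4, a6⟩ : WeierstrassCurve ℚ).analyticRank = 1)
    {N : ℕ} [NeZero N] (D : ModularParametrizationData (⟨a1, a2, a3, a4, a6⟩ : WeierstrassCurve ℚ) N)
    {k : ℕ} (hk : 1 ≤ k) (hk4 : k ≤ 4) (ℓ : ℕ) [hℓ : Fact ℓ.Prime] (h5 : 5 ≤ ℓ)
    (hℓΔ : ¬ (ℓ : ℤ) ∣ discOf [a1, a2, a3, a4, a6]) (h1 : ℓ ≡ 1 [MOD 3 ^ k]) {nℓ : ℕ}
    (hnℓ : countPointsFast [a1, a2, a3, a4, a6] ℓ = nℓ) (hdvd : 3 ^ k ∣ nℓ)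
    (hΔ0 : ((discOf [a1, a2, a3, a4, a6] : ℤ) : ZMod ℓ) ≠ 0)
    (hχ : ((discOf [a1, a2, a3, a4, a6] : ℤ) : ZMod ℓ) ^ ((ℓ - 1) / 3) ≠ 1)
    (ψ : (ℓ'' : ℕ) → (ZMod ℓ'')ˣ →* Multiplicative (ZMod (3 ^ k)))
    (hψ : Function.Surjective (ψ ℓ))
    (hδ : kuriharaNumber D.f (3 ^ k) ℓ ψ ≠ 0)
    (hcard : 3 ^ 2 ∣ Nat.card ((⟨a1, a2, a3, a4, a6⟩ : WeierstrassCurve ℚ).selmerGroup ((3 : ℕ) : ℤ)))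
    {q : ℚ} (hq : shaAn (⟨a1, a2, a3, a4, a6⟩ : WeierstrassCurve ℚ) = (q : ℂ)) (hv : padicValRat 3 q = 2) :
    BSDp (⟨a1, a2, a3, a4, a6⟩ : WeierstrassCurve ℚ) 3 :=
  X8RankOne.bsdp_three_of_kim2025_OPEN_of_ainvs_of_kuriharaNumber_ne_zero_of_card_selmerGroup hK25s hCT hGZK
    hmod a1 a2 a3 a4 a6 hmin h3Δ hc₃ hn17 hsurj hr D hk hk4 ℓ h5 hℓΔ h1
    (natCard_point_eq_of_countPoints a1 a2 a3 a4 a6 ℓ (by omega) hℓΔ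
      (countPoints_eq_of_fast hnℓ)) hdvd hΔ0 hχ ψ hψ hδ hcard hq hv

end Literal

end Summit.BirchSwinnertonDyer.Rank1Residual.Supersingular

end
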